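import Summits.ValiantsHypothesis.ValiantsHypothesis.Theorems.FifoMatchingNNDivisionHardExactPencilReadCube
import HarnessLib

/-! # Exact pencils II-c (val-idea-38 g4; crux `FifoMatching.NNDivisionHard`, stmt-ValiantsHypothesis-21181) — THE ZONOTOPE CLOSURE LEMMA IN KERNEL

§13d ★★★ `cor_add_subexpGenCube_decided`: EVERY affine cube passenger `{Q₀ + Σ_{t∈P} G_t : P ⊆ [N]}` with
`N + K(c,n) < 2^{⌊n / 4K(c,n)⌋}` generators (`K(c,n) = 2(log₂ n + c)^c + 6`) is DECIDED — `T c n < r` for every EF of size `r` of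
`COR(n) + cube` — with NO hypothesis on the generators (memo `ExactPencil38.md` §2i «zonotope closure lemma», steps (ii)+(iii), paper
PASS val-idea-crit-9 V#113a; there with equipartitions and the constant `2^{n/(2K)−2}`, here with ALL labellings `Fin n → Fin K` counted by
`Fintype.piFinset`, constant `2^{⌊n/4K⌋} − K`).

PROOF.  Fix a dead set `Z ≠ ∅` with `|Zᶜ| ≥ n/2` and a labelling `f : Fin n → Fin K` of the live rows; the located pair is
`β = lab Z f : Fin n → Fin (K+1)` (dead label `Fin.last K`).  By D1 part 15 ★★★ `cor_add_bound_of_cube_offT` the cube is decided at `(Z, β)`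
unless some nonzero generator is UNREAD (zero on dead rows/columns, symmetric, row-constant inside every live block).  COUNTING
(`exists_good_fun`): among the `K^n` labellings, those missing a live label on `Zᶜ` (`≤ K·(K−1)^m K^{n−m}`) and those separating NO
pair of unequal live rows of a fixed generator (`≤ (K−1)^m K^{n−m}` each, `m = ⌊n/4⌋`: the smaller row class has `≥ |Zᶜ|/2` live rows
outside it, all of which must dodge one label) are fewer than `K^n` as soon as `(N + K)(K−1)^m < K^m`, which `N + K < 2^{⌊n/4K⌋}` gives through
`K^K ≥ 2(K−1)^K` (ℕ-Bernoulli).  Under a good labelling an unread generator has all live rows equal, hence is `c·𝟙_{Zᶜ}𝟙_{Zᶜ}ᵀ`, `c ≠ 0`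
(`offT_or_constOn`), and `Z ↦` such a generator is INJECTIVE (`constOn_inj`: `x ∈ Z ↔ g x x = 0`).  Running `Z` over the `2^{n−⌊n/2⌋} − 1 > N`
nonempty subsets of a fixed half `H` gives the contradiction.

HONEST LABEL: an instance theorem (DECIDED SPECIES: affine cubes with sub-exponentially many generators) of the OPEN law
C′ = `LocatedRows.ExactPencilLaw` ≡ COR-VIRTUAL (`exactPencilLaw_iff_corVirtualHardN` ✓ p688316); the residual cube portrait
(`N ≥ 2^{⌊n/4K⌋} − K` generators, `𝒥`-type, (E-0) budget on the enemy) is untouched; the crux 21181 `NNDivisionHard` is OPEN; 0 enemies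
in sight.  VP ≠ VNP is NOT proved here or anywhere in this tree.
-/

set_option autoImplicit false

-- the mandated summit-side namespace repeats a component by design (single-problem summit)
set_option linter.dupNamespace false

noncomputable section

open Matrix Finset
open scoped Pointwise

namespace Summit.ValiantsHypothesis.ValiantsHypothesis.Cruxes.NNDivisionHard.ExactPencilC

open Literature.Barriers.PneNP (HasEFOfSize)
open Literature.Combinatorics.Optimization.FixedSizePsdRank (corPolytope flat)
open Summit.ValiantsHypothesis.ValiantsHypothesis.Theorems.FifoMatching.LocatedRows (T cubePt)
open Summit.ValiantsHypothesis.ValiantsHypothesis.Theorems.FifoMatching.ExactPencil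

/-! ### §13d-A ℕ-numerics: `K^K ≥ 2(K−1)^K` and `2^q (K−1)^m ≤ K^m` for `m ≥ qK` -/

section Numerics

/-- the first two binomial terms: `a^{k+1} + (k+1)a^k ≤ (a+1)^{k+1}`. -/
theorem pow_add_mul_pow_le (a : ℕ) : ∀ k : ℕ, a ^ (k + 1) + (k + 1) * a ^ k ≤ (a + 1) ^ (k + 1)
  | 0 => by simp
  | k + 1 => by
    have ih := pow_add_mul_pow_le a k
    have h1 : a ^ (k + 2) + (k + 2) * a ^ (k + 1) ≤ (a ^ (k + 1) + (k + 1) * a ^ k) * (a + 1) := by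
      have : (a ^ (k + 1) + (k + 1) * a ^ k) * (a + 1) = a ^ (k + 2) + (k + 2) * a ^ (k + 1) + (k + 1) * a ^ k := by
        ring
      rw [this]
      exact Nat.le_add_right _ _
    calc a ^ (k + 2) + (k + 2) * a ^ (k + 1) ≤ (a ^ (k + 1) + (k + 1) * a ^ k) * (a + 1) := h1
      _ ≤ (a + 1) ^ (k + 1) * (a + 1) := Nat.mul_le_mul_right _ ih
      _ = (a + 1) ^ (k + 2) := by ring

/-- ℕ-Bernoulli: `2·a^{a+1} ≤ (a+1)^{a+1}`, i.e. `(1 − 1/K)^K ≤ 1/2` for `K = a + 1`. -/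
theorem two_mul_pow_le (a : ℕ) : 2 * a ^ (a + 1) ≤ (a + 1) ^ (a + 1) := by
  have h := pow_add_mul_pow_le a a
  calc 2 * a ^ (a + 1) = a ^ (a + 1) + a * a ^ a := by ring
    _ ≤ a ^ (a + 1) + (a + 1) * a ^ a := by gcongr; exact Nat.le_succ a
    _ ≤ (a + 1) ^ (a + 1) := h

/-- `2^q (K−1)^{qK+s} ≤ K^{qK+s}` (`K ≥ 1`). -/
theorem two_pow_mul_pow_le (K q s : ℕ) (hK : 1 ≤ K) : 2 ^ q * (K - 1) ^ (q * K + s) ≤ K ^ (q * K + s) := by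
  obtain ⟨a, rfl⟩ : ∃ a, K = a + 1 := ⟨K - 1, by omega⟩
  rw [Nat.add_sub_cancel]
  calc 2 ^ q * a ^ (q * (a + 1) + s) = (2 * a ^ (a + 1)) ^ q * a ^ s := by
        rw [mul_pow, ← pow_mul, pow_add]; ring
    _ ≤ ((a + 1) ^ (a + 1)) ^ q * (a + 1) ^ s :=
        Nat.mul_le_mul (Nat.pow_le_pow_left (two_mul_pow_le a) q) (Nat.pow_le_pow_left (Nat.le_succ a) s)
    _ = (a + 1) ^ (q * (a + 1) + s) := by rw [← pow_mul, ← pow_add]; ring_nf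

/-- the threshold in use: `N + K < 2^q`, `qK ≤ m` ⟹ `(N + K)(K−1)^m < K^m` (`K ≥ 2`). -/
theorem threshold_lt (N K q m : ℕ) (hK : 2 ≤ K) (hN : N + K < 2 ^ q) (hm : q * K ≤ m) :
    (N + K) * (K - 1) ^ m < K ^ m := by
  obtain ⟨s, rfl⟩ : ∃ s, m = q * K + s := ⟨m - q * K, by omega⟩
  have hpos : 0 < (K - 1) ^ (q * K + s) := Nat.pow_pos (by omega)
  calc (N + K) * (K - 1) ^ (q * K + s) < 2 ^ q * (K - 1) ^ (q * K + s) := Nat.mul_lt_mul_of_pos_right hN hpos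
    _ ≤ K ^ (q * K + s) := two_pow_mul_pow_le K q s (by omega)

/-- antitonicity of `(K−1)^h K^{n−h}` in `h ≤ n`. -/
theorem pow_mul_pow_antitone (K n m h : ℕ) (hmh : m ≤ h) (hhn : h ≤ n) :
    (K - 1) ^ h * K ^ (n - h) ≤ (K - 1) ^ m * K ^ (n - m) := by
  obtain ⟨d, rfl⟩ : ∃ d, h = m + d := ⟨h - m, by omega⟩
  have hn : n - m = d + (n - (m + d)) := by omega
  rw [hn, pow_add, pow_add, mul_assoc]
  refine Nat.mul_le_mul_left _ (Nat.mul_le_mul_right _ (Nat.pow_le_pow_left (Nat.sub_le K 1) d))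

/-- a two-valued product with at least `m` small factors. -/
theorem prod_ite_mem_le {n : ℕ} (K m : ℕ) (S : Finset (Fin n)) (hm : m ≤ S.card) :
    ∏ y : Fin n, (if y ∈ S then K - 1 else K) ≤ (K - 1) ^ m * K ^ (n - m) := by
  classical
  rw [Finset.prod_ite, Finset.prod_const, Finset.prod_const]
  have h1 : (Finset.univ.filter fun y : Fin n => y ∈ S) = S := by
    ext y; simp
  have h2 : (Finset.univ.filter fun y : Fin n => ¬ y ∈ S).card = n - S.card := by
    rw [Finset.filter_not, h1, Finset.card_univ_sdiff, Fintype.card_fin]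
  rw [h1, h2]
  exact pow_mul_pow_antitone K n m S.card hm (by simpa using Finset.card_le_univ S)

end Numerics

/-! ### §13d-B the located pair `(Z, lab Z f)`, the unread shape `ConstOn`, and the dichotomy -/

section Located

variable {n : ℕ}

/-- the labelling of the located pair: dead label `Fin.last K` on `Z`, live label `f x` elsewhere. -/
def lab {K : ℕ} (Z : Finset (Fin n)) (f : Fin n → Fin K) : Fin n → Fin (K + 1) :=
  fun x => if x ∈ Z then Fin.last K else (f x).castSucc

theorem lab_mem_iff {K : ℕ} (Z : Finset (Fin n)) (f : Fin n → Fin K) (x : Fin n) :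
    lab Z f x ∈ ({Fin.last K} : Finset (Fin (K + 1))) ↔ x ∈ Z := by
  rw [Finset.mem_singleton]
  unfold lab
  split_ifs with h
  · simp [h]
  · simp only [h, iff_false]
    exact (Fin.castSucc_lt_last (f x)).ne

theorem lab_eq_of_eq {K : ℕ} (Z : Finset (Fin n)) (f : Fin n → Fin K) {x x' : Fin n} (hx : x ∉ Z) (hx' : x' ∉ Z)
    (h : f x = f x') : lab Z f x = lab Z f x' := by
  simp [lab, hx, hx', h]

/-- every label is attained: the dead one on `Z ≠ ∅`, the live ones by hypothesis. -/
theorem lab_section {K : ℕ} (Z : Finset (Fin n)) (f : Fin n → Fin K) (hZ : Z.Nonempty)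
    (hsurj : ∀ j : Fin K, ∃ y, y ∉ Z ∧ f y = j) : ∃ σ : Fin (K + 1) → Fin n, ∀ i, lab Z f (σ i) = i := by
  obtain ⟨z, hz⟩ := hZ
  choose y hy using hsurj
  refine ⟨fun i => Fin.lastCases (motive := fun _ => Fin n) z y i, fun i => ?_⟩
  induction i using Fin.lastCases with
  | last => simp [Fin.lastCases_last, lab, hz]
  | cast j => simp [Fin.lastCases_castSucc, lab, (hy j).1, (hy j).2]

/-- the UNREAD SHAPE at dead set `Z`: zero on dead rows and columns, one nonzero constant on `Zᶜ × Zᶜ` (`g = c·𝟙_{Zᶜ}𝟙_{Zᶜ}ᵀ`). -/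
def ConstOn (g : Matrix (Fin n) (Fin n) ℝ) (Z : Finset (Fin n)) : Prop :=
  (∀ x y, (x ∈ Z ∨ y ∈ Z) → g x y = 0) ∧ ∃ c : ℝ, c ≠ 0 ∧ ∀ x y, x ∉ Z → y ∉ Z → g x y = c

/-- ★ the unread shape determines its dead set (`x ∈ Z ↔ g x x = 0`): `Z ↦` an unread generator is injective. -/
theorem constOn_inj {g : Matrix (Fin n) (Fin n) ℝ} {Z Z' : Finset (Fin n)} (h : ConstOn g Z) (h' : ConstOn g Z') :
    Z = Z' := by
  obtain ⟨hz, c, hc, hcst⟩ := h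
  obtain ⟨hz', c', hc', hcst'⟩ := h'
  ext x
  constructor
  · intro hx
    by_contra hx'
    exact hc' ((hcst' x x hx' hx').symm.trans (hz x x (Or.inl hx)))
  · intro hx'
    by_contra hx
    exact hc ((hcst x x hx hx).symm.trans (hz' x x (Or.inl hx')))

/-- ★ DICHOTOMY: under a labelling that puts two UNEQUAL live rows of `g` into one block whenever `g` has two unequal live rows,
a nonzero generator is either READ at `(Z, lab Z f)` (dead entry / row move / column move / transpose move, the hypothesis of
★★★ `cor_add_bound_of_cube_offT`) or has the unread shape `ConstOn g Z`. -/
theorem offT_or_constOn {K : ℕ} (Z : Finset (Fin n)) (f : Fin n → Fin K) (g : Matrix (Fin n) (Fin n) ℝ) (hg : g ≠ 0)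
    (hL : ∃ x₀, x₀ ∉ Z)
    (hgood : (∃ x₁, x₁ ∉ Z ∧ ∃ x₂, x₂ ∉ Z ∧ ∃ y, g x₁ y ≠ g x₂ y) →
      ∃ x x', x ∉ Z ∧ x' ∉ Z ∧ f x = f x' ∧ ∃ y, g x y ≠ g x' y) :
    ((∃ x y, g x y ≠ 0 ∧ (lab Z f x ∈ ({Fin.last K} : Finset (Fin (K + 1))) ∨
        lab Z f y ∈ ({Fin.last K} : Finset (Fin (K + 1))))) ∨
      (∃ x x' y, lab Z f x = lab Z f x' ∧ g x y ≠ g x' y) ∨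
      (∃ x y y', lab Z f y = lab Z f y' ∧ g x y ≠ g x y') ∨ (∃ x y, g x y ≠ g y x)) ∨ ConstOn g Z := by
  by_cases h1 : ∃ x y, g x y ≠ 0 ∧ (x ∈ Z ∨ y ∈ Z)
  · obtain ⟨x, y, hxy, hd⟩ := h1
    refine Or.inl (Or.inl ⟨x, y, hxy, ?_⟩)
    rwa [lab_mem_iff, lab_mem_iff]
  push Not at h1
  by_cases h2 : ∃ x y, g x y ≠ g y x
  · exact Or.inl (Or.inr (Or.inr (Or.inr h2)))
  push Not at h2
  by_cases h3 : ∃ x₁, x₁ ∉ Z ∧ ∃ x₂, x₂ ∉ Z ∧ ∃ y, g x₁ y ≠ g x₂ y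
  · obtain ⟨x, x', hx, hx', hf, y, hy⟩ := hgood h3
    exact Or.inl (Or.inr (Or.inl ⟨x, x', y, lab_eq_of_eq Z f hx hx' hf, hy⟩))
  push Not at h3
  right
  obtain ⟨x₀, hx₀⟩ := hL
  have hzero : ∀ x y, (x ∈ Z ∨ y ∈ Z) → g x y = 0 := fun x y hxy => by
    by_contra hne
    rcases hxy with hx | hy
    · exact (h1 x y hne).1 hx
    · exact (h1 x y hne).2 hy
  have hconst : ∀ x y, x ∉ Z → y ∉ Z → g x y = g x₀ x₀ := fun x y hx hy => by
    rw [h3 x hx x₀ hx₀ y, h2 x₀ y, h3 y hy x₀ hx₀ x₀]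
  refine ⟨hzero, g x₀ x₀, fun hc => hg ?_, hconst⟩
  ext x y
  rw [Matrix.zero_apply]
  by_cases hxy : x ∈ Z ∨ y ∈ Z
  · exact hzero x y hxy
  · push Not at hxy
    rw [hconst x y hxy.1 hxy.2, hc]

end Located

/-! ### §13d-C COUNTING over all labellings `Fin n → Fin K` (`Fintype.piFinset`) -/

section Counting

variable {n : ℕ}

/-- ★ COUNTING = steps (ii)+(iii) of the closure lemma over ALL labellings: if `(|I| + K)(K−1)^m K^{n−m} < K^n`, some
`f : Fin n → Fin K` attains every label on `Zᶜ` AND, for every `t ∈ I`, gives the base row `x t` the label of some row of `M t`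
(`x t ∉ M t`, `|M t| ≥ m`).  Bad labellings: missing label `j` on `Zᶜ` (`K^{|Z|}(K−1)^{|Zᶜ|}` each), or `M t` dodging the label of `x t`
(`Σ_v (K−1)^{|M t|} K^{n−1−|M t|}` each) — both `≤ (K−1)^m K^{n−m}`. -/
theorem exists_good_fun {K : ℕ} {ι : Type*} (I : Finset ι) (Z : Finset (Fin n)) (x : ι → Fin n)
    (M : ι → Finset (Fin n)) (hxM : ∀ t ∈ I, x t ∉ M t) (m : ℕ) (hMm : ∀ t ∈ I, m ≤ (M t).card)
    (hZm : m ≤ Zᶜ.card) (hnum : (I.card + K) * ((K - 1) ^ m * K ^ (n - m)) < K ^ n) :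
    ∃ f : Fin n → Fin K, (∀ j : Fin K, ∃ y, y ∉ Z ∧ f y = j) ∧ ∀ t ∈ I, ∃ x', x' ∈ M t ∧ f x' = f (x t) := by
  classical
  -- the two bad families of labellings
  let bad1 : Fin K → Finset (Fin n → Fin K) := fun j =>
    Fintype.piFinset fun y => if y ∈ Z then (Finset.univ : Finset (Fin K)) else Finset.univ.erase j
  let cell : ι → Fin K → Fin n → Finset (Fin K) := fun t v y =>
    if y = x t then {v} else if y ∈ M t then Finset.univ.erase v else Finset.univ
  let bad2 : ι → Finset (Fin n → Fin K) := fun t => Finset.univ.biUnion fun v => Fintype.piFinset (cell t v)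
  -- their sizes
  have hK1 : ∀ j : Fin K, (bad1 j).card ≤ (K - 1) ^ m * K ^ (n - m) := by
    intro j
    dsimp only [bad1]
    rw [Fintype.card_piFinset]
    have hc : ∀ y : Fin n, (if y ∈ Z then (Finset.univ : Finset (Fin K)) else Finset.univ.erase j).card
        = if y ∈ Zᶜ then K - 1 else K := by
      intro y
      by_cases hy : y ∈ Z
      · simp [hy, Finset.card_univ]
      · simp [hy, Finset.card_erase_of_mem, Finset.card_univ]
    rw [Finset.prod_congr rfl fun y _ => hc y]
    exact prod_ite_mem_le K m Zᶜ hZm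
  have hK2 : ∀ t ∈ I, (bad2 t).card ≤ (K - 1) ^ m * K ^ (n - m) := by
    intro t ht
    let d : Fin n → ℕ := fun y => if y ∈ M t then K - 1 else K
    have hcell : ∀ v, (Fintype.piFinset (cell t v)).card = ∏ y ∈ Finset.univ.erase (x t), d y := by
      intro v
      rw [Fintype.card_piFinset, ← Finset.mul_prod_erase Finset.univ (fun y => (cell t v y).card) (Finset.mem_univ (x t))]
      have h0 : (cell t v (x t)).card = 1 := by simp [cell]
      rw [h0, one_mul]
      refine Finset.prod_congr rfl fun y hy => ?_
      have hyx : y ≠ x t := Finset.ne_of_mem_erase hy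
      by_cases hyM : y ∈ M t
      · simp [cell, d, hyx, hyM, Finset.card_erase_of_mem, Finset.card_univ]
      · simp [cell, d, hyx, hyM, Finset.card_univ]
    have hdx : d (x t) = K := by simp [d, hxM t ht]
    dsimp only [bad2]
    calc (Finset.univ.biUnion fun v => Fintype.piFinset (cell t v)).card
        ≤ ∑ v, (Fintype.piFinset (cell t v)).card := Finset.card_biUnion_le
      _ = K * ∏ y ∈ Finset.univ.erase (x t), d y := by
          rw [Finset.sum_congr rfl fun v _ => hcell v, Finset.sum_const, Finset.card_univ, Fintype.card_fin,
            smul_eq_mul]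
      _ = ∏ y, d y := by
          rw [← Finset.mul_prod_erase Finset.univ d (Finset.mem_univ (x t)), hdx]
      _ ≤ (K - 1) ^ m * K ^ (n - m) := prod_ite_mem_le K m (M t) (hMm t ht)
  -- a labelling outside every bad set exists by counting
  set B : Finset (Fin n → Fin K) := (Finset.univ.biUnion bad1) ∪ I.biUnion bad2 with hB
  have hBcard : B.card < (Finset.univ : Finset (Fin n → Fin K)).card := by
    calc B.card ≤ (Finset.univ.biUnion bad1).card + (I.biUnion bad2).card := Finset.card_union_le _ _
      _ ≤ (∑ j, (bad1 j).card) + ∑ t ∈ I, (bad2 t).card :=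
          Nat.add_le_add Finset.card_biUnion_le Finset.card_biUnion_le
      _ ≤ (∑ _j : Fin K, (K - 1) ^ m * K ^ (n - m)) + ∑ _t ∈ I, (K - 1) ^ m * K ^ (n - m) :=
          Nat.add_le_add (Finset.sum_le_sum fun j _ => hK1 j) (Finset.sum_le_sum fun t ht => hK2 t ht)
      _ = (I.card + K) * ((K - 1) ^ m * K ^ (n - m)) := by
          rw [Finset.sum_const, Finset.sum_const, Finset.card_univ, Fintype.card_fin, smul_eq_mul, smul_eq_mul]
          ring
      _ < K ^ n := hnum
      _ = (Finset.univ : Finset (Fin n → Fin K)).card := by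
          rw [Finset.card_univ, Fintype.card_fun, Fintype.card_fin, Fintype.card_fin]
  obtain ⟨f, -, hf⟩ := Finset.exists_mem_notMem_of_card_lt_card hBcard
  rw [hB, Finset.mem_union, not_or, Finset.mem_biUnion, Finset.mem_biUnion, not_exists, not_exists] at hf
  refine ⟨f, fun j => ?_, fun t ht => ?_⟩
  · have hj : f ∉ bad1 j := fun h => hf.1 j ⟨Finset.mem_univ j, h⟩
    dsimp only [bad1] at hj
    rw [Fintype.mem_piFinset] at hj
    push Not at hj
    obtain ⟨y, hy⟩ := hj
    by_cases hyZ : y ∈ Z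
    · simp [hyZ] at hy
    · refine ⟨y, hyZ, ?_⟩
      simpa [hyZ, Finset.mem_erase] using hy
  · by_contra hne
    push Not at hne
    apply hf.2 t ⟨ht, ?_⟩
    dsimp only [bad2]
    rw [Finset.mem_biUnion]
    refine ⟨f (x t), Finset.mem_univ _, Fintype.mem_piFinset.2 fun y => ?_⟩
    by_cases hyx : y = x t
    · subst hyx
      simp [cell]
    · by_cases hyM : y ∈ M t
      · simpa [cell, hyx, hyM, Finset.mem_erase] using hne y hyM
      · simp [cell, hyx, hyM]

end Counting

/-! ### §13d-D ★★★ THE ZONOTOPE CLOSURE LEMMA -/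

section Closure

variable {n : ℕ}

/-- two unequal live rows ⇒ a base row `x₀ ∉ Z` and a set `M₀` of at least `|Zᶜ|/2` live rows all unequal to row `x₀`
(the complement in `Zᶜ` of the SMALLER of the two row classes). -/
theorem exists_base_and_far {g : Matrix (Fin n) (Fin n) ℝ} {Z : Finset (Fin n)}
    (h : ∃ x₁, x₁ ∉ Z ∧ ∃ x₂, x₂ ∉ Z ∧ ∃ y, g x₁ y ≠ g x₂ y) :
    ∃ (x₀ : Fin n) (M₀ : Finset (Fin n)), x₀ ∉ Z ∧ x₀ ∉ M₀ ∧ Zᶜ.card / 2 ≤ M₀.card ∧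
      ∀ x' ∈ M₀, x' ∉ Z ∧ ∃ y, g x₀ y ≠ g x' y := by
  classical
  obtain ⟨x₁, hx₁, x₂, hx₂, y, hy⟩ := h
  have hne : g x₁ ≠ g x₂ := fun he => hy (congrFun he y)
  let far : Fin n → Finset (Fin n) := fun x₀ => Zᶜ.filter fun x' => ¬ g x' = g x₀
  have hfar : ∀ x₀, ∀ x' ∈ far x₀, x' ∉ Z ∧ ∃ y, g x₀ y ≠ g x' y := by
    intro x₀ x' hx'
    dsimp only [far] at hx'
    rw [Finset.mem_filter, Finset.mem_compl] at hx'
    exact ⟨hx'.1, Function.ne_iff.1 (Ne.symm hx'.2)⟩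
  have hself : ∀ x₀, x₀ ∉ far x₀ := fun x₀ h => by simp [far] at h
  have hsum : Zᶜ.card ≤ (far x₁).card + (far x₂).card := by
    have h1 : (Zᶜ.filter fun x' => g x' = g x₁).card + (far x₁).card = Zᶜ.card :=
      Finset.card_filter_add_card_filter_not _
    have h2 : (Zᶜ.filter fun x' => g x' = g x₁) ⊆ far x₂ := by
      intro x' hx'
      dsimp only [far]
      rw [Finset.mem_filter] at hx' ⊢
      exact ⟨hx'.1, fun he => hne (hx'.2.symm.trans he)⟩
    have := Finset.card_le_card h2
    omega
  by_cases hc : Zᶜ.card / 2 ≤ (far x₁).card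
  · exact ⟨x₁, far x₁, hx₁, hself x₁, hc, hfar x₁⟩
  · exact ⟨x₂, far x₂, hx₂, hself x₂, by omega, hfar x₂⟩

/-- ★★★ **THE ZONOTOPE CLOSURE LEMMA** (memo `ExactPencil38.md` §2i, steps (ii)+(iii), now kernel): EVERY affine cube passenger
`{Q₀ + Σ_{t∈P} G_t : P ⊆ [N]}` with `N + K(c,n) < 2^{⌊n/4K(c,n)⌋}` generators, `K(c,n) = 2(log₂ n + c)^c + 6`, is DECIDED —
`T c n < r` for every EF of size `r` of `COR(n) + cube` — with NO hypothesis on the generators, for every such `n`. -/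
theorem cor_add_subexpGenCube_decided (c : ℕ) {N : ℕ}
    (hN : N + (2 * (Nat.log 2 n + c) ^ c + 6) < 2 ^ (n / (4 * (2 * (Nat.log 2 n + c) ^ c + 6))))
    (Q₀ : Matrix (Fin n) (Fin n) ℝ) (G : Fin N → Matrix (Fin n) (Fin n) ℝ) (r : ℕ)
    (hEF : HasEFOfSize (corPolytope n + convexHull ℝ (Set.range (cubePt Q₀ G))) r) : T c n < r := by
  classical
  set K : ℕ := 2 * (Nat.log 2 n + c) ^ c + 6 with hK
  have hK6 : 6 ≤ K := by omega
  -- numerics: `n ≥ 12K`, the threshold `(N + K)(K−1)^{n/4} < K^{n/4}`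
  have hq3 : 3 ≤ n / (4 * K) := by
    by_contra hlt
    have h4 : 2 ^ (n / (4 * K)) ≤ 4 :=
      le_trans (Nat.pow_le_pow_right (by norm_num) (by omega : n / (4 * K) ≤ 2)) (by norm_num)
    omega
  have hn : 12 * K ≤ n := by
    have := (Nat.le_div_iff_mul_le (by omega : 0 < 4 * K)).1 hq3
    omega
  have hq4 : n / (4 * K) ≤ n / 4 := Nat.div_le_div_left (by omega) (by norm_num)
  have hqm : n / (4 * K) * K ≤ n / 4 := by
    rw [← Nat.div_div_eq_div_mul]
    exact Nat.div_mul_le_self _ _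
  have hthr : (N + K) * (K - 1) ^ (n / 4) < K ^ (n / 4) :=
    threshold_lt N K (n / (4 * K)) (n / 4) (by omega) hN hqm
  by_contra hr
  -- the half `H` and the family of dead sets: nonempty subsets of `H`
  obtain ⟨H, -, hH⟩ := Finset.exists_subset_card_eq (s := (Finset.univ : Finset (Fin n))) (n := n - n / 2)
    (by rw [Finset.card_univ, Fintype.card_fin]; omega)
  set Fam : Finset (Finset (Fin n)) := H.powerset.erase ∅ with hFam
  have hFam_mem : ∀ Z ∈ Fam, Z.Nonempty ∧ n / 2 ≤ Zᶜ.card := by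
    intro Z hZ
    rw [hFam, Finset.mem_erase, Finset.mem_powerset] at hZ
    refine ⟨Finset.nonempty_iff_ne_empty.2 hZ.1, ?_⟩
    rw [Finset.card_compl, Fintype.card_fin]
    have := Finset.card_le_card hZ.2
    omega
  have hHFam : H ∈ Fam := by
    rw [hFam, Finset.mem_erase, Finset.mem_powerset]
    refine ⟨fun he => ?_, subset_rfl⟩
    rw [he, Finset.card_empty] at hH
    omega
  -- ★ every dead set of the family owns an UNREAD generator `c·𝟙_{Zᶜ}𝟙_{Zᶜ}ᵀ`
  have hex : ∀ Z ∈ Fam, ∃ t, ConstOn (G t) Z := by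
    intro Z hZ
    obtain ⟨hZne, hZc⟩ := hFam_mem Z hZ
    have hL : ∃ x₀, x₀ ∉ Z := by
      obtain ⟨x₀, hx₀⟩ := (Finset.card_pos.1 (by omega) : Zᶜ.Nonempty)
      exact ⟨x₀, Finset.mem_compl.1 hx₀⟩
    -- base rows `x t` and far sets `M t` for the generators with two unequal live rows
    have hxM : ∀ t : Fin N, ∃ (x₀ : Fin n) (M₀ : Finset (Fin n)), x₀ ∉ M₀ ∧
        ((∃ x₁, x₁ ∉ Z ∧ ∃ x₂, x₂ ∉ Z ∧ ∃ y, G t x₁ y ≠ G t x₂ y) →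
          x₀ ∉ Z ∧ n / 4 ≤ M₀.card ∧ ∀ x' ∈ M₀, x' ∉ Z ∧ ∃ y, G t x₀ y ≠ G t x' y) := by
      intro t
      by_cases hMC : ∃ x₁, x₁ ∉ Z ∧ ∃ x₂, x₂ ∉ Z ∧ ∃ y, G t x₁ y ≠ G t x₂ y
      · obtain ⟨x₀, M₀, hx₀Z, hx₀M, hcard, hM⟩ := exists_base_and_far hMC
        exact ⟨x₀, M₀, hx₀M, fun _ => ⟨hx₀Z, by omega, hM⟩⟩
      · obtain ⟨x₀, -⟩ := hL
        exact ⟨x₀, ∅, by simp, fun h => (hMC h).elim⟩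
    choose x M hxM hgoodM using hxM
    let I : Finset (Fin N) := Finset.univ.filter fun t =>
      ∃ x₁, x₁ ∉ Z ∧ ∃ x₂, x₂ ∉ Z ∧ ∃ y, G t x₁ y ≠ G t x₂ y
    have hI : ∀ t ∈ I, ∃ x₁, x₁ ∉ Z ∧ ∃ x₂, x₂ ∉ Z ∧ ∃ y, G t x₁ y ≠ G t x₂ y := fun t ht =>
      (Finset.mem_filter.1 ht).2
    have hnum : (I.card + K) * ((K - 1) ^ (n / 4) * K ^ (n - n / 4)) < K ^ n := by
      have hIN : I.card ≤ N := by
        calc I.card ≤ (Finset.univ : Finset (Fin N)).card := Finset.card_le_card (Finset.filter_subset _ _)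
          _ = N := by rw [Finset.card_univ, Fintype.card_fin]
      have hpos : 0 < K ^ (n - n / 4) := Nat.pow_pos (by omega)
      calc (I.card + K) * ((K - 1) ^ (n / 4) * K ^ (n - n / 4))
          ≤ (N + K) * ((K - 1) ^ (n / 4) * K ^ (n - n / 4)) := Nat.mul_le_mul_right _ (by omega)
        _ = (N + K) * (K - 1) ^ (n / 4) * K ^ (n - n / 4) := by ring
        _ < K ^ (n / 4) * K ^ (n - n / 4) := Nat.mul_lt_mul_of_pos_right hthr hpos
        _ = K ^ n := by rw [← pow_add]; congr 1; omega
    obtain ⟨f, hsurj, hcoll⟩ := exists_good_fun I Z x M (fun t _ => hxM t) (n / 4)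
      (fun t ht => (hgoodM t (hI t ht)).2.1) (by omega) hnum
    obtain ⟨σ, hσ⟩ := lab_section Z f hZne hsurj
    by_contra hnone
    push Not at hnone
    have hread : ∀ t, G t ≠ 0 →
        (∃ x y, G t x y ≠ 0 ∧ (lab Z f x ∈ ({Fin.last K} : Finset (Fin (K + 1))) ∨
            lab Z f y ∈ ({Fin.last K} : Finset (Fin (K + 1))))) ∨
          (∃ x x' y, lab Z f x = lab Z f x' ∧ G t x y ≠ G t x' y) ∨
          (∃ x y y', lab Z f y = lab Z f y' ∧ G t x y ≠ G t x y') ∨ (∃ x y, G t x y ≠ G t y x) := by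
      intro t ht
      refine (offT_or_constOn Z f (G t) ht hL fun hMC => ?_).resolve_right (hnone t)
      have htI : t ∈ I := Finset.mem_filter.2 ⟨Finset.mem_univ t, hMC⟩
      obtain ⟨x', hx'M, hfx'⟩ := hcoll t htI
      obtain ⟨hxZ, -, hM⟩ := hgoodM t hMC
      obtain ⟨hx'Z, y, hy⟩ := hM x' hx'M
      exact ⟨x t, x', hxZ, hx'Z, hfx'.symm, y, hy⟩
    have hbound := cor_add_bound_of_cube_offT hσ ({Fin.last K} : Finset (Fin (K + 1))) Q₀ G hread r hEF
    rw [Finset.card_singleton, Nat.add_sub_cancel] at hbound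
    exact hr (T_lt_of_block_uniform c n K r hK.ge hbound)
  -- ★ `Z ↦` its unread generator is injective on the family: `2^{n − ⌊n/2⌋} − 1 ≤ N`, contradiction
  rcases Nat.eq_zero_or_pos N with hN0 | hNpos
  · subst hN0
    obtain ⟨t, -⟩ := hex H hHFam
    exact t.elim0
  haveI : Nonempty (Fin N) := ⟨⟨0, hNpos⟩⟩
  choose! tZ htZ using hex
  have hinj : Set.InjOn tZ (Fam : Set (Finset (Fin n))) := by
    intro Z hZ Z' hZ' he
    exact constOn_inj (htZ Z hZ) (he ▸ htZ Z' hZ')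
  have hcard : Fam.card ≤ N := by
    calc Fam.card ≤ (Finset.univ : Finset (Fin N)).card :=
          Finset.card_le_card_of_injOn tZ (by intro Z _; exact Finset.mem_coe.2 (Finset.mem_univ _)) hinj
      _ = N := by rw [Finset.card_univ, Fintype.card_fin]
  have hFam_card : Fam.card = 2 ^ (n - n / 2) - 1 := by
    rw [hFam, Finset.card_erase_of_mem (Finset.mem_powerset.2 (Finset.empty_subset H)), Finset.card_powerset, hH]
  have h2 : 2 ^ (n / (4 * K)) ≤ 2 ^ (n - n / 2) := Nat.pow_le_pow_right (by norm_num) (by omega)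
  omega

end Closure

/-! ### §13d-E audit: the fully qualified reading and the axioms -/

/-- the closure lemma, every constant spelled out (no `open`). -/
example (c n N : ℕ)
    (hN : N + (2 * (Nat.log 2 n + c) ^ c + 6) < 2 ^ (n / (4 * (2 * (Nat.log 2 n + c) ^ c + 6))))
    (Q₀ : Matrix (Fin n) (Fin n) ℝ) (G : Fin N → Matrix (Fin n) (Fin n) ℝ) (r : ℕ)
    (hEF : Literature.Barriers.PneNP.HasEFOfSize
      (Literature.Combinatorics.Optimization.FixedSizePsdRank.corPolytope n +
        convexHull ℝ (Set.range
          (Summit.ValiantsHypothesis.ValiantsHypothesis.Theorems.FifoMatching.LocatedRows.cubePt Q₀ G))) r) :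
    Summit.ValiantsHypothesis.ValiantsHypothesis.Theorems.FifoMatching.LocatedRows.T c n < r :=
  cor_add_subexpGenCube_decided c hN Q₀ G r hEF

/-- the threshold unfolded: `T c n = 2^{(log₂ n + c)^c}` is beaten by every EF of `COR(n) + cube`. -/
example (c n N : ℕ)
    (hN : N + (2 * (Nat.log 2 n + c) ^ c + 6) < 2 ^ (n / (4 * (2 * (Nat.log 2 n + c) ^ c + 6))))
    (Q₀ : Matrix (Fin n) (Fin n) ℝ) (G : Fin N → Matrix (Fin n) (Fin n) ℝ) (r : ℕ)
    (hEF : HasEFOfSize (corPolytope n + convexHull ℝ (Set.range (cubePt Q₀ G))) r) :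
    2 ^ ((Nat.log 2 n + c) ^ c) < r :=
  cor_add_subexpGenCube_decided c hN Q₀ G r hEF

#print axioms cor_add_subexpGenCube_decided




end Summit.ValiantsHypothesis.ValiantsHypothesis.Cruxes.NNDivisionHard.ExactPencilC
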